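import Literature.NumberTheory.GelbartRogawski1991.LocalRankTwoGaloisConjSimilitudeCoinvariants
import Literature.NumberTheory.GelbartRogawski1991.LocalScaleTransportCoinvariants
import Literature.RepresentationTheory.TwistedCoinvariantsConjugateTransports
import HarnessLib

/-!
# Rank two, non-split place: `Θ_{ξ∘bar₁}(s_{χ′}^{−T₀}) ≅ (ξ∘det⁻¹) ⊗ Θ_ξ(s_χ^{(det T₀)⁻¹T₀})` ON THE MEMBERS' OWN MODELS

Topic `NumberTheory/GelbartRogawski1991`; namespace `Literature.NumberTheory.GelbartRogawski1991.UnitaryDualPair.LocalSplitting`.  KERNEL ONLY: one theorem; no definition,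
no named fact, no `sorry`.  Cell `hodgecm-mathlib` (D-0151), programme P5 (crux HLiu418 = stmt-HodgeConjecture-24832), piece **(C4b)** of the road card
`F0/P5/A-p18/g23/ROAD-L4if-v3.A-p18g23.md` §8 (A-p18 (g23), 2026-09-01): ★ (C4)-core `exists_coinv_equiv_galConj_similitude` read on the two members' OWN Weil
representations `ω^{−T₀} ∘ s_{χ′}^{−T₀}` and `ω^{(det T₀)⁻¹T₀} ∘ s_χ^{(det T₀)⁻¹T₀}` through ★ (C4a) `exists_coinv_equiv_scaleTransportSection` (twice) and the conjugation
lemma ★ `TwistedCoinv.exists_conj_twisted_intertwiner`.  Statement: **`∃ E′ : (ω^{T₀′}∘s_{χ′}^{T₀′})_{Z, ξ∘bar₁} ≃ (ω^{T₀″}∘s_χ^{T₀″})_{Z,ξ}`** (`T₀′ = −T₀`, `T₀″ = (det T₀)⁻¹T₀`),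
**`E′ ∘ rep(scaleInl_{−1} g) = ξ((det g)⁻¹·1) • rep(scaleInl_{(det T₀)⁻¹} g) ∘ E′`** for every `g ∈ U(T₀)(L⁺_v)` — «`Θ_{ξ⁻¹}(λᶜ, −a) ≅ (ξ∘det⁻¹) ⊗ Θ_ξ(λ, (det T_a)⁻¹·a)`»
([Liu2021, Lem. D.1 (4)] in the in-house transport form; the letter follows with B2 and the class bookkeeping, road card §8 steps 3–5).
Nothing of the cited sources is asserted; HC_CM is proved only modulo the printed citations until rung 0 closes.

## References
* [Liu2021] Y. Liu, App. D §D.1 Step 3 (l. 5221), Lemma D.1 (4) (l. 5235).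
* [MoeglinVignerasWaldspurger1987] LNM 1291 (1987), Chap. 1 I.17, Chap. 2 II.1–II.2, Chap. 3 I.1.
* [GelbartRogawski1991] S. Gelbart, J. Rogawski, Invent. Math. 105 (1991), §3.1 p. 454, Remark p. 457 L4–13.
-/

set_option autoImplicit false
set_option Elab.async false

noncomputable section

open scoped Matrix
open NumberField IsDedekindDomain MeasureTheory Matrix
open Literature.RepresentationTheory.HeisenbergGroup
open Literature.NumberTheory.Automorphic Literature.NumberTheory.Automorphic.UnitaryGroup Literature.NumberTheory.Weil1964
open Literature.NumberTheory.GaloisRepresentations Literature.RepresentationTheory.HarrisKudlaSweet1996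
open Literature.RepresentationTheory.TwistedCoinv

namespace Literature.NumberTheory.GelbartRogawski1991.UnitaryDualPair.LocalSplitting

variable (L : Type) [Field L] [NumberField L] [IsCMField L] (v : HeightOneSpectrum (𝓞 (maximalRealSubfield L)))
  [MeasurableSpace (v.adicCompletion (maximalRealSubfield L))] [BorelSpace (v.adicCompletion (maximalRealSubfield L))]
  (μ : Measure (v.adicCompletion (maximalRealSubfield L))) [μ.IsAddHaarMeasure]
  {T₀ T₀' T₀'' : Matrix (Fin 2) (Fin 2) (maximalRealSubfield L)} {J₀ J₀' J₀'' : Matrix (Fin 2) (Fin 2) L}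
  {T₁ : Matrix (Fin 1) (Fin 1) (maximalRealSubfield L)} {J₁ : Matrix (Fin 1) (Fin 1) L} (hT₁ : IsUnit T₁.det)
  (hJ₁ : J₁ = T₁.map (algebraMap (maximalRealSubfield L) L)) (hJ₁0 : J₁ 0 0 ≠ 0)

include hT₁ hJ₁ in
set_option synthInstance.maxHeartbeats 400000 in
set_option maxHeartbeats 4000000 in
/-- **(C4b): `Θ_{ξ∘bar₁}(ω^{−T₀} ∘ s_{χ′}^{−T₀}) ≅ (ξ∘det⁻¹) ⊗ Θ_ξ(ω^{(det T₀)⁻¹T₀} ∘ s_χ^{(det T₀)⁻¹T₀})` on the members' own models** (rank 2, non-split `v`).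
[cite: Liu2021, App. D Lemma D.1 (4) (l. 5235), §D.1 Step 3 (l. 5221)] [cite: MoeglinVignerasWaldspurger1987, Chap. 2 II.1–II.2]
[cite: GelbartRogawski1991, §3.1 Remark p. 457 L4–13] -/
theorem exists_coinv_equiv_galConj_similitude_models
    (t : Fin 2 → maximalRealSubfield L) (hT₀t : T₀ = Matrix.diagonal t) (hT₀ : T₀.IsSymm) (hT₀d : IsUnit T₀.det) (hTd : T₀.det ≠ 0)
    (hT₀' : T₀'.IsSymm) (hT₀'d : IsUnit T₀'.det) (hTT₀' : T₀' = ((-1 : (maximalRealSubfield L)ˣ) : maximalRealSubfield L) • T₀)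
    (hT₀'' : T₀''.IsSymm) (hT₀''d : IsUnit T₀''.det) (hTT₀'' : T₀'' = (((Units.mk0 T₀.det hTd)⁻¹ : (maximalRealSubfield L)ˣ) : maximalRealSubfield L) • T₀)
    (hJ₀ : J₀ = T₀.map (algebraMap (maximalRealSubfield L) L)) (hJ₀' : J₀' = T₀'.map (algebraMap (maximalRealSubfield L) L))
    (hJ₀'' : J₀'' = T₀''.map (algebraMap (maximalRealSubfield L) L))
    (hns : ∀ w : PlacesOver L v, IsCMField.complexConj L • w.1 = w.1)
    (χ χ' : HeckeCharacter L) (hχ : IsSplittingChar L 1 χ) (hχ' : IsSplittingChar L 1 χ')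
    (hχχ' : ∀ (w : PlacesOver L v),
      (χ'.localComponent w.1)⁻¹ = (χ.localComponent w.1)⁻¹.comp
        (Units.map (galAdicCompletionMap (L := L) (IsCMField.complexConj L) (hns w) : w.1.adicCompletion L →* w.1.adicCompletion L)))
    (m : LocalMp (maximalRealSubfield L) (2 + 2) (gramD (maximalRealSubfield L) 2 T₀) v)
    (hm : (deltaLagrangian (maximalRealSubfield L) v 2).map (toLin (maximalRealSubfield L) v (MpPsi.proj _ m)) =
      lagrangianY (maximalRealSubfield L) (2 + 2) v)
    (ξ : UnitaryGroup.localPi L (IsCMField.complexConj L) 1 J₁ v →* ℂˣ) :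
    ∃ E' : Coinv (((MpPsi.toRep (localSchrodinger (maximalRealSubfield L) 2 T₀' v)).comp (localSplittingCMWith L 2 hT₀' hT₀'d hJ₀' χ' hχ' v μ)).comp (localCenter L (IsCMField.complexConj L) 2 J₀' J₁ hJ₁0 v)) (ξ.comp (localPiGalConj L (IsCMField.complexConj L) 1 v hJ₁)) ≃ₗ[ℂ] Coinv (((MpPsi.toRep (localSchrodinger (maximalRealSubfield L) 2 T₀'' v)).comp (localSplittingCMWith L 2 hT₀'' hT₀''d hJ₀'' χ hχ v μ)).comp (localCenter L (IsCMField.complexConj L) 2 J₀'' J₁ hJ₁0 v)) ξ,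
      ∀ (g : UnitaryGroup.localPi L (IsCMField.complexConj L) 2 J₀ v) (x' : Coinv (((MpPsi.toRep (localSchrodinger (maximalRealSubfield L) 2 T₀' v)).comp (localSplittingCMWith L 2 hT₀' hT₀'d hJ₀' χ' hχ' v μ)).comp (localCenter L (IsCMField.complexConj L) 2 J₀' J₁ hJ₁0 v)) (ξ.comp (localPiGalConj L (IsCMField.complexConj L) 1 v hJ₁))),
        E' (rep (ξ.comp (localPiGalConj L (IsCMField.complexConj L) 1 v hJ₁)) ((MpPsi.toRep (localSchrodinger (maximalRealSubfield L) 2 T₀' v)).comp (localSplittingCMWith L 2 hT₀' hT₀'d hJ₀' χ' hχ' v μ)) (commute_comp_localCenter' hJ₁0 ((MpPsi.toRep (localSchrodinger (maximalRealSubfield L) 2 T₀' v)).comp (localSplittingCMWith L 2 hT₀' hT₀'d hJ₀' χ' hχ' v μ))) (scaleInl (maximalRealSubfield L) L (IsCMField.complexConj L) 2 T₀ T₀' (-1) hTT₀' hJ₀ hJ₀' v g) x') =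
          (((ξ (localUnitScalar L (IsCMField.complexConj L) J₁ v _ (inv_det_mul_conjLocal_inv_det L (IsCMField.complexConj L) hJ₀ v (complexConj_imagUnit L) (imagUnit_ne_zero L) hTd g)) : ℂˣ) : ℂ)) • rep ξ ((MpPsi.toRep (localSchrodinger (maximalRealSubfield L) 2 T₀'' v)).comp (localSplittingCMWith L 2 hT₀'' hT₀''d hJ₀'' χ hχ v μ)) (commute_comp_localCenter' hJ₁0 ((MpPsi.toRep (localSchrodinger (maximalRealSubfield L) 2 T₀'' v)).comp (localSplittingCMWith L 2 hT₀'' hT₀''d hJ₀'' χ hχ v μ))) (scaleInl (maximalRealSubfield L) L (IsCMField.complexConj L) 2 T₀ T₀'' (Units.mk0 T₀.det hTd)⁻¹ hTT₀'' hJ₀ hJ₀'' v g) (E' x') :=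
  exists_conj_twisted_intertwiner
    (fun g => rep (ξ.comp (localPiGalConj L (IsCMField.complexConj L) 1 v hJ₁)) ((MpPsi.toRep (localSchrodinger (maximalRealSubfield L) 2 T₀ v)).comp (scaleTransportSection (maximalRealSubfield L) L (IsCMField.complexConj L) 2 (complexConj_imagUnit L) (imagUnit_ne_zero L) (imagUnit_mul_self L) T₀ T₀' hT₀ hT₀' (-1) hTT₀' hJ₀ hJ₀' v (localSplittingCMWith L 2 hT₀' hT₀'d hJ₀' χ' hχ' v μ) (proj_localSplittingCMWith L 2 hT₀' hT₀'d hJ₀' χ' hχ' v μ))) (commute_comp_localCenter' hJ₁0 ((MpPsi.toRep (localSchrodinger (maximalRealSubfield L) 2 T₀ v)).comp (scaleTransportSection (maximalRealSubfield L) L (IsCMField.complexConj L) 2 (complexConj_imagUnit L) (imagUnit_ne_zero L) (imagUnit_mul_self L) T₀ T₀' hT₀ hT₀' (-1) hTT₀' hJ₀ hJ₀' v (localSplittingCMWith L 2 hT₀' hT₀'d hJ₀' χ' hχ' v μ) (proj_localSplittingCMWith L 2 hT₀' hT₀'d hJ₀' χ' hχ' v μ)))) g)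
    (fun g => rep ξ ((MpPsi.toRep (localSchrodinger (maximalRealSubfield L) 2 T₀ v)).comp (scaleTransportSection (maximalRealSubfield L) L (IsCMField.complexConj L) 2 (complexConj_imagUnit L) (imagUnit_ne_zero L) (imagUnit_mul_self L) T₀ T₀'' hT₀ hT₀'' (Units.mk0 T₀.det hTd)⁻¹ hTT₀'' hJ₀ hJ₀'' v (localSplittingCMWith L 2 hT₀'' hT₀''d hJ₀'' χ hχ v μ) (proj_localSplittingCMWith L 2 hT₀'' hT₀''d hJ₀'' χ hχ v μ))) (commute_comp_localCenter' hJ₁0 ((MpPsi.toRep (localSchrodinger (maximalRealSubfield L) 2 T₀ v)).comp (scaleTransportSection (maximalRealSubfield L) L (IsCMField.complexConj L) 2 (complexConj_imagUnit L) (imagUnit_ne_zero L) (imagUnit_mul_self L) T₀ T₀'' hT₀ hT₀'' (Units.mk0 T₀.det hTd)⁻¹ hTT₀'' hJ₀ hJ₀'' v (localSplittingCMWith L 2 hT₀'' hT₀''d hJ₀'' χ hχ v μ) (proj_localSplittingCMWith L 2 hT₀'' hT₀''d hJ₀'' χ hχ v μ)))) g)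
    (fun g => rep (ξ.comp (localPiGalConj L (IsCMField.complexConj L) 1 v hJ₁)) ((MpPsi.toRep (localSchrodinger (maximalRealSubfield L) 2 T₀' v)).comp (localSplittingCMWith L 2 hT₀' hT₀'d hJ₀' χ' hχ' v μ)) (commute_comp_localCenter' hJ₁0 ((MpPsi.toRep (localSchrodinger (maximalRealSubfield L) 2 T₀' v)).comp (localSplittingCMWith L 2 hT₀' hT₀'d hJ₀' χ' hχ' v μ))) (scaleInl (maximalRealSubfield L) L (IsCMField.complexConj L) 2 T₀ T₀' (-1) hTT₀' hJ₀ hJ₀' v g))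
    (fun g => rep ξ ((MpPsi.toRep (localSchrodinger (maximalRealSubfield L) 2 T₀'' v)).comp (localSplittingCMWith L 2 hT₀'' hT₀''d hJ₀'' χ hχ v μ)) (commute_comp_localCenter' hJ₁0 ((MpPsi.toRep (localSchrodinger (maximalRealSubfield L) 2 T₀'' v)).comp (localSplittingCMWith L 2 hT₀'' hT₀''d hJ₀'' χ hχ v μ))) (scaleInl (maximalRealSubfield L) L (IsCMField.complexConj L) 2 T₀ T₀'' (Units.mk0 T₀.det hTd)⁻¹ hTT₀'' hJ₀ hJ₀'' v g))
    (fun g => (((ξ (localUnitScalar L (IsCMField.complexConj L) J₁ v _ (inv_det_mul_conjLocal_inv_det L (IsCMField.complexConj L) hJ₀ v (complexConj_imagUnit L) (imagUnit_ne_zero L) hTd g)) : ℂˣ) : ℂ)))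
    (exists_coinv_equiv_galConj_similitude L v μ hT₁ hJ₁ hJ₁0 t hT₀t hT₀ hT₀d hTd hT₀' hT₀'d hTT₀' hT₀'' hT₀''d hTT₀'' hJ₀ hJ₀' hJ₀'' hns χ χ' hχ hχ' hχχ'
      m hm ξ)
    (exists_coinv_equiv_scaleTransportSection (maximalRealSubfield L) L (IsCMField.complexConj L) 2 (complexConj_imagUnit L) (imagUnit_ne_zero L) (imagUnit_mul_self L) T₀ T₀' hT₀ hT₀' (-1) hTT₀' hJ₀ hJ₀' hJ₁0 v (localSplittingCMWith L 2 hT₀' hT₀'d hJ₀' χ' hχ' v μ) (proj_localSplittingCMWith L 2 hT₀' hT₀'d hJ₀' χ' hχ' v μ) (ξ.comp (localPiGalConj L (IsCMField.complexConj L) 1 v hJ₁)) (commute_comp_localCenter' hJ₁0 ((MpPsi.toRep (localSchrodinger (maximalRealSubfield L) 2 T₀ v)).comp (scaleTransportSection (maximalRealSubfield L) L (IsCMField.complexConj L) 2 (complexConj_imagUnit L) (imagUnit_ne_zero L) (imagUnit_mul_self L) T₀ T₀' hT₀ hT₀' (-1) hTT₀' hJ₀ hJ₀' v (localSplittingCMWith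 L 2 hT₀' hT₀'d hJ₀' χ' hχ' v μ) (proj_localSplittingCMWith L 2 hT₀' hT₀'d hJ₀' χ' hχ' v μ)))) (commute_comp_localCenter' hJ₁0 ((MpPsi.toRep (localSchrodinger (maximalRealSubfield L) 2 T₀' v)).comp (localSplittingCMWith L 2 hT₀' hT₀'d hJ₀' χ' hχ' v μ))))
    (exists_coinv_equiv_scaleTransportSection (maximalRealSubfield L) L (IsCMField.complexConj L) 2 (complexConj_imagUnit L) (imagUnit_ne_zero L) (imagUnit_mul_self L) T₀ T₀'' hT₀ hT₀'' (Units.mk0 T₀.det hTd)⁻¹ hTT₀'' hJ₀ hJ₀'' hJ₁0 v (localSplittingCMWith L 2 hT₀'' hT₀''d hJ₀'' χ hχ v μ) (proj_localSplittingCMWith L 2 hT₀'' hT₀''d hJ₀'' χ hχ v μ) ξ (commute_comp_localCenter' hJ₁0 ((MpPsi.toRep (localSchrodinger (maximalRealSubfield L) 2 T₀ v)).comp (scaleTransportSection (maximalRealSubfield L) L (IsCMField.complexConj L) 2 (complexConj_imagUnit L) (imagUnit_ne_zero L) (imagUnit_mul_self L) T₀ T₀'' hT₀ hT₀'' (Units.mk0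 T₀.det hTd)⁻¹ hTT₀'' hJ₀ hJ₀'' v (localSplittingCMWith L 2 hT₀'' hT₀''d hJ₀'' χ hχ v μ) (proj_localSplittingCMWith L 2 hT₀'' hT₀''d hJ₀'' χ hχ v μ)))) (commute_comp_localCenter' hJ₁0 ((MpPsi.toRep (localSchrodinger (maximalRealSubfield L) 2 T₀'' v)).comp (localSplittingCMWith L 2 hT₀'' hT₀''d hJ₀'' χ hχ v μ))))

end Literature.NumberTheory.GelbartRogawski1991.UnitaryDualPair.LocalSplitting

end
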